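import Summits.BirchSwinnertonDyer.BirchSwinnertonDyer.Theses.BiquadraticEisensteinDescent
import Summits.BirchSwinnertonDyer.Rank1Residual.X11b.BDPRouteOpenInputIdealRigidity
import Summits.BirchSwinnertonDyer.Rank1Residual.X11b.AnticyclotomicModuleFinite
import Summits.BirchSwinnertonDyer.BirchSwinnertonDyer.Theorems.BiquadraticEisensteinDescentEisensteinHeartFlatCMInertBadKPrimeCMDatumAdapter
import Summits.BirchSwinnertonDyer.BirchSwinnertonDyer.Theorems.BiquadraticEisensteinDescentEisensteinHeartFlatCMInertBadKPrimeSqrtEndomorphismAllJ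
import Summits.BirchSwinnertonDyer.BirchSwinnertonDyer.Theorems.BiquadraticEisensteinDescentEisensteinHeartFlatCMInertBadKPrimeKatzHsiehSocket
import Summits.BirchSwinnertonDyer.BirchSwinnertonDyer.Theorems.BiquadraticEisensteinDescentEisensteinHeartFlatCMInertBadKPrimeCuspCoeffVanishing
import Summits.BirchSwinnertonDyer.BirchSwinnertonDyer.Theorems.BiquadraticEisensteinDescentEisensteinHeartFlatCMInertBadKPrimeConstantScaling
import Summits.BirchSwinnertonDyer.BirchSwinnertonDyer.Theorems.BiquadraticEisensteinDescentEisensteinHeartFlatCMInertBadKPrimeHsiehWitness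
import Summits.BirchSwinnertonDyer.BirchSwinnertonDyer.Theorems.BiquadraticEisensteinDescentEisensteinHeartFlatCMInertBadKPrimeStubV2AllJ
import HarnessLib

/-!
# Crux `EisensteinHeartFlatCMInertBadKPrime` (stmt-BirchSwinnertonDyer-21341) FROM THREE PRINT FACTS AND ONE INPUT —
# the line `hsieh_lambda` v3 (skeleton cc08ae1089e5f3a0) as ONE kernel theorem

Route `BiquadraticEisensteinDescent` (cell `pub/bsd-wall`, lead-prover seat `bsd-wall-cm-bed-p1` g1). The ♭-heart over `K′` — THE ROUTE DECL
BY NAME — follows from (A) Hsieh Doc. Math. 19 Thm A at any level (`Hsieh2014.thmA_exists_isHsiehLFunction_unrPeriod_anyLevel`, route input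
h8); (Katz) Katz 1978 (5.3.0) / Hida–Tilouine 1993 Thm II / Hsieh 2014 Prop 4.9 (`hsieh2014mu_prop49_exists_isMeasure`); (Deuring) Silverman
AT II Thms 9.2/10.5 (`Deuring_exists_heckeCharacter_of_maximalCM`); and (V4K) THE INPUT = the registered stub `stub_V4K` taken as a
hypothesis VERBATIM (for every tied Katz line frame `G` of `L = K′·K_CM` on the `K′`-line and every admissible CM datum, `∃ m,
p^m·Ch_{𝒪⟦T⟧}(N)·𝓞_ℂp⟦T⟧ ⊆ (G)` for the `ψ_L`-branch module `N` — Hsieh JAMS 27 (2014) Thm 8.14's object on the `p`-RAMIFIED branch,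
μ-blind; NOT in print: HSIEH-AWAY-FROM-P-AUDIT (C3)/(I′)), through the width seats' landed layer 2: `stub_hsiehWitness_of_thmA` (p594900),
`SqrtEndomorphismAllJ.stub_sqrtEndomorphism` (p621092), `StubV2AllJ.stub_V2_of_katz_of_deuring` (p625968), the one-call V3
`CMDatumAdapter.heartShape_xac_of_sqrt_endomorphism`, the V2 display `KatzHsiehDisplay.exists_span_C_mul_eq`, `ConstantScaling` and the
ideal rigidity `X11b.span_singleton_eq_of_isHsiehLFunction_of_isBDPLFunctionInt`. So modulo three PUBLISHED facts the crux IS the input.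
THEOREM ONLY (conditional on four hypotheses, `proof.conditional`); nothing about BSD is asserted. Supports, does not close, 21341.
-/

set_option linter.dupNamespace false
set_option autoImplicit false

noncomputable section

open scoped Classical NumberField

open WeierstrassCurve NumberField IsDedekindDomain Field PowerSeries
  Literature.NumberTheory.EllipticCurves Literature.NumberTheory.EllipticCurves.ModularForms
  Literature.NumberTheory.EllipticCurves.Rank1Residual
  Literature.NumberTheory.EllipticCurves.Hsieh2014
  Literature.NumberTheory.EllipticCurves.GreenbergSelmer
  Literature.NumberTheory.EllipticCurves.Module
  Literature.NumberTheory.EllipticCurves.IwasawaDual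
  Literature.NumberTheory.GaloisRepresentations
  Summit.BirchSwinnertonDyer.Rank1Residual Summit.BirchSwinnertonDyer.Rank1Residual.X11b
  Summit.BirchSwinnertonDyer.Rank1Residual.X11b.AcSelmer
  Summit.BirchSwinnertonDyer.BirchSwinnertonDyer.Theorems.BiquadraticEisensteinDescentDefs
  Summit.BirchSwinnertonDyer.BirchSwinnertonDyer.Theorems.BiquadraticEisensteinDescentEisensteinHeartFlatCMInertBadKPrimeSelmerTower
  Summit.BirchSwinnertonDyer.BirchSwinnertonDyer.Theorems.BiquadraticEisensteinDescentEisensteinHeartFlatCMInertBadKPrimeShapiroDatum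
  Summit.BirchSwinnertonDyer.BirchSwinnertonDyer.Theorems.BiquadraticEisensteinDescentEisensteinHeartFlatCMInertBadKPrimeCMDatumAdapter

namespace Summit.BirchSwinnertonDyer.BirchSwinnertonDyer.Theorems.BiquadraticEisensteinDescentEisensteinHeartFlatCMInertBadKPrimeOfV4K

open Summit.BirchSwinnertonDyer.BirchSwinnertonDyer.Theses.BiquadraticEisensteinDescent
open Summit.BirchSwinnertonDyer.BirchSwinnertonDyer.Theorems.BiquadraticEisensteinDescentEisensteinHeartFlatCMInertBadKPrimeCMDatumAdapter

/-- **The ♭-heart crux from (A) + (Katz) + (Deuring) + the input V4K** (module docstring): skeleton v3's composition with its three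
non-research stubs replaced by their landed conditional closers. [cite: Hsieh2014, Thm. A p. 712 (Doc. Math. 19)]
[cite: Hsieh2014mu, Prop. 4.9 (§4.8)] [cite: SilvermanATAEC1994, Ch. II Thm. 9.2 and Thm. 10.5 (b)] [cite: PollackRubin2004, proof of Thm. 7.3]
[cite: Castella2018, Thm. 3.1 (arXiv:1704.06608 p. 9)] -/
theorem eisensteinHeartFlatCMInertBadKPrime_of_V4K_of_facts
    (hA : Literature.NumberTheory.EllipticCurves.Hsieh2014.thmA_exists_isHsiehLFunction_unrPeriod_anyLevel)
    (hKatz : hsieh2014mu_prop49_exists_isMeasure) (hD : Deuring_exists_heckeCharacter_of_maximalCM)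
    (hV4K : ∀ (W : WeierstrassCurve ℚ) [W.IsElliptic] [W.IsGloballyMinimal] (p : ℕ) [Fact p.Prime]
        [NeZero (W.conductorNorm ℤ)] (K : Type) [Field K] [NumberField K],
        W.HasCM → 5 ≤ p → CMInert W p → ¬ Good W p →
        IsImaginaryQuadratic K → SatisfiesHeegnerHypothesis (W.conductorNorm ℤ) K →
        4 < (NumberField.discr K).natAbs → ¬ p ∣ NumberField.classNumber K →
        ∀ (κ : ZpExtension K p), κ.IsAnticyclotomic →
          ∀ (γ : Field.absoluteGaloisGroup K) [Fact (κ.IsTopGenerator γ)]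
            (𝔭 : HeightOneSpectrum (𝓞 K)), ((p : ℕ) : 𝓞 K) ∈ 𝔭.asIdeal →
            𝔭.asIdeal.ramificationIdx (𝓞 ℚ) = 1 → 𝔭.asIdeal.inertiaDeg (𝓞 ℚ) = 1 →
            ∀ (f : CuspForm (CongruenceSubgroup.Gamma0 (W.conductorNorm ℤ)) 2), IsNewformOf W f →
              ∀ (ι' : PadicAlgCl p ≃+* ℂ),
                (∀ (w : InfinitePlace K) (k : 𝓞 K), k ∈ 𝔭.asIdeal ↔ ‖ι'.symm (w.embedding (k : K))‖ < 1) →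
                    ∀ (𝔭' : HeightOneSpectrum (𝓞 K)), ((p : ℕ) : 𝓞 K) ∈ 𝔭'.asIdeal → 𝔭' ≠ 𝔭 →
                    Module.IsTorsion (IwasawaAlgebra p) (XAc (W.baseChange K) p κ 𝔭' ∅ γ) →
                    ∀ (L : Type) [Field L] [NumberField L] [Algebra K L] [IsGalois K L]
                      (Sp S T : Finset (HeightOneSpectrum (𝓞 L))) (lam : HeckeCharacter L) (ϑ : L) (CK : ℂ)
                      (Ω : InfinitePlace L → ℂ) (ΩpK : InfinitePlace L → ℂ_[p]) (G : PowerSeries 𝓞_ℂ_[p])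
                      (w₁ w₂ : InfinitePlace L) (cL cL' : ℂ),
                      w₁ ≠ w₂ → (∀ w : InfinitePlace L, w = w₁ ∨ w = w₂) →
                      (∀ (χ : HeckeCharacter K) (n : ℕ), 0 < n → (∀ v : HeightOneSpectrum (𝓞 K), χ.IsUnramifiedAt v) →
                        χ.HasInfinityType (fun _ ↦ (n : ℤ)) (fun _ ↦ -(n : ℤ)) →
                        KatzCM.HasKatzType ι' Sp (lam * χ.compRelNorm L) 1 (fun w ↦ if w = w₁ then n else n - 1)) →
                      (∀ (χ : HeckeCharacter K) (n : ℕ), 0 < n → (∀ v : HeightOneSpectrum (𝓞 K), χ.IsUnramifiedAt v) →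
                        χ.HasInfinityType (fun _ ↦ (n : ℤ)) (fun _ ↦ -(n : ℤ)) →
                        LFunction.HasEntireContinuation (heckeLFunction (lam * χ.compRelNorm L))) →
                      cL ≠ 0 → cL' ≠ 0 →
                      (∀ (χ : HeckeCharacter K) (n : ℕ), 0 < n → (∀ v : HeightOneSpectrum (𝓞 K), χ.IsUnramifiedAt v) →
                        χ.HasInfinityType (fun _ ↦ (n : ℤ)) (fun _ ↦ -(n : ℤ)) →
                        ∀ hL : LFunction.HasEntireContinuation (heckeLFunction (lam * χ.compRelNorm L)),
                          hL.continuation 0 = cL * cL' ^ n * rankinSelbergValueHecke f χ 1) →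
                      (∀ w ∈ S ∪ KatzCM.primesOver L p, ¬ lam.IsUnramifiedAt w) →
                      (∀ w ∈ Sp ∪ T, ¬ lam.IsUnramifiedAt w) →
                      CK ≠ 0 → (∀ w, Ω w ≠ 0) → (∀ w, (KatzCM.embeddingAt ι' Sp w ϑ).im ≠ 0) → (∀ w, ΩpK w ≠ 0) →
                      KatzCM.IsBaseChangeLine ι' Sp S T κ γ lam ϑ CK Ω ΩpK G →
                    ∀ (d₀ : ℤ) (r : AlgebraicClosure K) (ψ : (W.baseChange K).geomPoints →+ (W.baseChange K).geomPoints),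
                      r * r = algebraMap K (AlgebraicClosure K) (d₀ : K) →
                      r ∉ Set.range (algebraMap K (AlgebraicClosure K)) →
                      (∀ y : ZMod p, y * y ≠ PadicInt.toZMod ((d₀ : ℤ) : ℤ_[p])) →
                      (∀ σ : absoluteGaloisGroup K, σ • r = r → ∀ P : (W.baseChange K).geomPoints, σ • ψ P = ψ (σ • P)) →
                      (∀ σ : absoluteGaloisGroup K, σ • r = -r → ∀ P : (W.baseChange K).geomPoints, σ • ψ P = -ψ (σ • P)) →
                      (∀ P, ψ (ψ P) = d₀ • P) →
                    ∀ (U : Subgroup (absoluteGaloisGroup K)) [U.Normal], (∀ σ, σ ∈ U ↔ σ • r = r) →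
                    ∀ (φ : (W.baseChange K).geomPrimaryTorsion p →+ (W.baseChange K).geomPrimaryTorsion p)
                      (_ : ∀ m, ((φ m : (W.baseChange K).geomPrimaryTorsion p) : (W.baseChange K).geomPoints) = ψ m)
                      (hφH' : ∀ (x : (κ.kerSubgroup ⊓ U : Subgroup (absoluteGaloisGroup K)))
                        (m : (W.baseChange K).geomPrimaryTorsion p), φ (x • m) = x • φ m)
                      (hφU : ∀ σ ∈ U, ∀ m : (W.baseChange K).geomPrimaryTorsion p, φ (σ • m) = σ • φ m)
                      (hφU' : ∀ σ, σ ∉ U → ∀ m : (W.baseChange K).geomPrimaryTorsion p, φ (σ • m) = -(σ • φ m))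
                      (hφ2 : ∀ m, φ (φ m) = d₀ • m)
                      (γ' : absoluteGaloisGroup K) (_ : κ.IsTopGenerator γ') (_ : γ' ∈ U)
                      (f₁ : AddMonoid.End (selmerOver (κ.kerSubgroup ⊓ U) ((W.baseChange K).geomPrimaryTorsion p) p 𝔭' ∅))
                      (_hf : ∀ s, ((f₁ s : selmerOver (κ.kerSubgroup ⊓ U) ((W.baseChange K).geomPrimaryTorsion p) p 𝔭' ∅) :
                        subgroupH1 (κ.kerSubgroup ⊓ U) ((W.baseChange K).geomPrimaryTorsion p)) =
                          conjH1 (κ.kerSubgroup ⊓ U) ((W.baseChange K).geomPrimaryTorsion p) γ' s)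
                      (h : IsLocNil p (f₁ - 1))
                      (δ : LocNilDual (selmerOver (κ.kerSubgroup ⊓ U) ((W.baseChange K).geomPrimaryTorsion p) p 𝔭' ∅) f₁ h
                        →ₗ[IwasawaAlgebra p]
                        LocNilDual (selmerOver (κ.kerSubgroup ⊓ U) ((W.baseChange K).geomPrimaryTorsion p) p 𝔭' ∅) f₁ h)
                      (hδ : ∀ (x : LocNilDual (selmerOver (κ.kerSubgroup ⊓ U) ((W.baseChange K).geomPrimaryTorsion p) p 𝔭' ∅) f₁ h)
                        (s t : selmerOver (κ.kerSubgroup ⊓ U) ((W.baseChange K).geomPrimaryTorsion p) p 𝔭' ∅),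
                        (t : subgroupH1 (κ.kerSubgroup ⊓ U) ((W.baseChange K).geomPrimaryTorsion p)) =
                          resH1Hom (ContinuousMonoidHom.id _) φ hφH'
                            (s : subgroupH1 (κ.kerSubgroup ⊓ U) ((W.baseChange K).geomPrimaryTorsion p)) → δ x s = x t)
                      (b : Module.Basis (Fin 2) ℤ_[p]
                        (AdjoinRoot (Polynomial.X ^ 2 - Polynomial.C ((d₀ : ℤ) : ℤ_[p]) : Polynomial ℤ_[p]))) (hb0 : b 0 = 1)
                      (hb1 : b 1 * b 1 = algebraMap ℤ_[p]
                        (AdjoinRoot (Polynomial.X ^ 2 - Polynomial.C ((d₀ : ℤ) : ℤ_[p]) : Polynomial ℤ_[p])) ((d₀ : ℤ) : ℤ_[p]))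
                      (ι : AdjoinRoot (Polynomial.X ^ 2 - Polynomial.C ((d₀ : ℤ) : ℤ_[p]) : Polynomial ℤ_[p]) →+* 𝓞_ℂ_[p])
                      (_ : ι.comp (algebraMap ℤ_[p] _) = R1.toCpInt p),
                      ∃ m : ℕ, ∀ x ∈ (charIdeal (PowerSeries
                          (AdjoinRoot (Polynomial.X ^ 2 - Polynomial.C ((d₀ : ℤ) : ℤ_[p]) : Polynomial ℤ_[p])))
                          (WithQuadratic (LocNilDual (selmerOver (κ.kerSubgroup ⊓ U) ((W.baseChange K).geomPrimaryTorsion p)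
                            p 𝔭' ∅) f₁ h) b hb0 hb1 δ
                            (delta_sq (W.baseChange K) κ 𝔭' ∅ U φ hφH' hφU hφU' d₀ hφ2 f₁ h δ hδ))).map (PowerSeries.map ι),
                        (PowerSeries.C ((p : ℕ) : 𝓞_ℂ_[p]) : PowerSeries 𝓞_ℂ_[p]) ^ m * x ∈ Ideal.span {G}) :
    EisensteinHeartFlatCMInertBadKPrime := by
  intro W _ _ p _ _ K _ _ hCM _hr hp5 hin hbad hK hHN hd4 hh _hLt κ hκ γ _ 𝔭 h𝔭 he hf1 f hf ι' hι ΩK Ωp Q hΩK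
    hQ 𝔭' h𝔭' hne htors
  have hp : p.Prime := Fact.out
  have hp2 : p ≠ 2 := by omega
  have hpN : p ∣ W.conductorNorm ℤ := (W.dvd_conductorNorm_iff_not_hasGoodReductionAtPrime p).mpr hbad
  have hγ : κ.IsTopGenerator γ := Fact.out
  -- a Hsieh witness of the same `(ι′, 𝔭, κ, γ, f)`
  obtain ⟨A, ΩK₁, C, Ωp₁, QH, hA, hΩK₁, hC, hQH⟩ :=
    Summit.BirchSwinnertonDyer.BirchSwinnertonDyer.Theorems.BiquadraticEisensteinDescentEisensteinHeartFlatCMInertBadKPrimeHsiehWitness.stub_hsiehWitness_of_thmA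
      hA W p K hp5 hbad hK hHN κ hκ γ 𝔭 h𝔭 f hf ι' hι
  -- the CM endomorphism `[√d₀]` over `K′` and the index-two subgroup `U = Γ_L`
  obtain ⟨d₀, r, ψ, hr, hrK, hd, hψU, hψU', hψ2⟩ := Summit.BirchSwinnertonDyer.BirchSwinnertonDyer.Theorems.BiquadraticEisensteinDescentEisensteinHeartFlatCMInertBadKPrimeSqrtEndomorphismAllJ.stub_sqrtEndomorphism
      W p K hCM hp5 hin hbad hK hHN 𝔭 𝔭' h𝔭 h𝔭' hne
  let U : Subgroup (absoluteGaloisGroup K) := MulAction.stabilizer (absoluteGaloisGroup K) r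
  have hUr : ∀ σ, σ ∈ U ↔ σ • r = r := fun σ ↦ MulAction.mem_stabilizer_iff
  haveI : U.Normal := normal_of_forall_mem_iff r (d₀ : K) hr hrK U hUr
  haveI : (W.baseChange K).IsElliptic := inferInstanceAs (W.map (algebraMap ℚ K)).IsElliptic
  haveI : Module.Finite (IwasawaAlgebra p) (XAc (W.baseChange K) p κ 𝔭' ∅ γ) := XAc.module_finite_empty κ 𝔭' γ
  have hΩp₁ : ((Ωp₁ : unrIntegers p) : ℂ_[p]) ≠ 0 := by
    rw [Ne, ZeroMemClass.coe_eq_zero]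
    exact Ωp₁.ne_zero
  have hΩp : ((Ωp : unrIntegers p) : ℂ_[p]) ≠ 0 := by
    rw [Ne, ZeroMemClass.coe_eq_zero]
    exact Ωp.ne_zero
  -- V3 (Shapiro, one call) + [V2 frame ∧ V4K input ∧ Katz–Hsieh display] for the upper module
  have hap : cuspCoeff f p = 0 :=
    Summit.BirchSwinnertonDyer.BirchSwinnertonDyer.Theorems.BiquadraticEisensteinDescentEisensteinHeartFlatCMInertBadKPrimeCuspCoeffVanishing.cuspCoeff_eq_zero_of_hasCM_of_not_good
      hCM hbad hf
  have hCH0 : C ≠ 0 := fun h0 ↦ by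
    rw [h0, map_zero] at hC
    simp at hC
  have hdiv : ∃ m : ℕ, ∀ x ∈ (XAc.charIdeal (W.baseChange K) p κ 𝔭' ∅ γ).map (PowerSeries.map (R1.toCpInt p)),
      (PowerSeries.C ((p : ℕ) : 𝓞_ℂ_[p]) : PowerSeries 𝓞_ℂ_[p]) ^ m * x ∈ Ideal.span {QH} := by
    refine heartShape_xac_of_sqrt_endomorphism (W.baseChange K) κ 𝔭' ∅ U hp2 γ ψ d₀ r hr hrK hUr hψU hψU' hψ2 hd htors ?_
    intro φ hφψ hφH' hφU hφU' hφ2 γ' hγ' hγ'U f₁ hf₁ h δ hδ b hb0 hb1 ιO hιO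
    -- the tied Katz line frame
    obtain ⟨L, _, _, _, _, Sp, S, T, lam, ϑ, CK, Ω, ΩpK, G, w₁, w₂, cL, cL', hw, huniv, hT, hcont, hcL, hcL', hLval, hramS,
      hramT, hCK, hΩ, hIm, hΩpK, hGK⟩ :=
      Summit.BirchSwinnertonDyer.BirchSwinnertonDyer.Theorems.BiquadraticEisensteinDescentEisensteinHeartFlatCMInertBadKPrimeStubV2AllJ.stub_V2_of_katz_of_deuring
        hKatz hD W p K hCM hp5 hin hbad hK hHN hd4 hh κ hκ γ 𝔭 h𝔭 he hf1 f hf ι' hι 𝔭' h𝔭' hne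
    -- THE INPUT for `G`
    obtain ⟨m, hm⟩ := hV4K W p K hCM hp5 hin hbad hK hHN hd4 hh κ hκ γ 𝔭 h𝔭 he hf1 f hf ι' hι 𝔭' h𝔭' hne htors
      L Sp S T lam ϑ CK Ω ΩpK G w₁ w₂ cL cL' hw huniv hT hcont hcL hcL' hLval hramS hramT hCK hΩ hIm hΩpK hGK
      d₀ r ψ hr hrK hd hψU hψU' hψ2 U hUr φ hφψ hφH' hφU hφU' hφ2 γ' hγ' hγ'U f₁ hf₁ h δ hδ b hb0 hb1 ιO hιO
    -- Katz–Hsieh display: `(c·G) = (c′·Q_H)`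
    obtain ⟨c, c', hc, hc', hspan⟩ :=
      Summit.BirchSwinnertonDyer.BirchSwinnertonDyer.Theorems.BiquadraticEisensteinDescentEisensteinHeartFlatCMInertBadKPrimeKatzHsiehDisplay.exists_span_C_mul_eq
        hp2 hK hκ hγ hQH hGK hw huniv hT hcont hcL hcL' hLval hpN hap hramS hramT hCK hΩ hIm hΩpK hA.ne' hΩK₁ hCH0 hΩp₁
    exact (Summit.BirchSwinnertonDyer.BirchSwinnertonDyer.Theorems.BiquadraticEisensteinDescentEisensteinHeartFlatCMInertBadKPrimeConstantScaling.heartShape_iff_of_span_C_mul_eq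
      hc hc' hspan _).mp ⟨m, hm⟩
  obtain ⟨m, hm⟩ := hdiv
  -- the witness and the ♭-frame generate the same ideal
  have hideal : Ideal.span ({QH} : Set (PowerSeries (PadicComplexInt p))) = Ideal.span {Q} :=
    span_singleton_eq_of_isHsiehLFunction_of_isBDPLFunctionInt hp2 hK hκ hγ hpN hA hΩK₁ hC hΩp₁ hQH hΩK
      hΩp hQ
  refine ⟨m, fun x hx ↦ ?_⟩
  rw [← hideal]
  exact hm x hx


end Summit.BirchSwinnertonDyer.BirchSwinnertonDyer.Theorems.BiquadraticEisensteinDescentEisensteinHeartFlatCMInertBadKPrimeOfV4K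

end
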